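import Mathlib.Analysis.InnerProductSpace.NormPow
import Mathlib.Analysis.Calculus.Deriv.Abs
import Mathlib.Analysis.Calculus.FDeriv.Extend
import Mathlib.Data.Sign.Basic
import Mathlib.Analysis.Calculus.Deriv.Shift
import HarnessLib

/-!
# Calculus of the power nonlinearities `|v|^p`, `|v|^{p-1} v`, `(v₊)^p` used in Moser's iteration

Analysis/FluidPDE proofs file (theorems only), on the discharge path of the named fact
`Literature.Analysis.FluidPDE.LeiZhang2011_liouville` (Z. Lei, Q. S. Zhang, J. Funct. Anal. 261
(2011) = arXiv:1011.5066, Theorem 1.2 via Theorem 1.1). Moser's iteration in §2 tests the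
swirl equation (1.5) with `q|Γ|^{2q-2}Γ ψ²` ("Consider the functions `f = |Γ|^q`", p. 6), i.e.
with `H'(Γ)ψ²` for `H(v) = |v|^{2q}`, and the Sobolev step uses `f ψ` with `f = |Γ|^q`; in §3
(Corollary 3.3) the same is done for the positive part `(δ − Φ)₊`. The tree's slice and energy
lemmas (`LeiZhang2011SliceEstimates`, `LeiZhang2011Energy`, `LeiZhang2011SobolevStep`) are
written for an abstract convex `H ∈ C²` with `H'² ≤ κ H H''` and a `C¹` "signed square root"
`s` (`s² = H`, `2 s'² ≤ H''`). This file supplies these data for the powers, for real `p > 2`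
(the iteration is started above `L²`, so `p = 2q > 2` throughout):

* `H = |v|^p`: `C²` (`contDiff_two_abs_rpow`), `H' = p|v|^{p-2}v`, `H'' = p(p-1)|v|^{p-2} ≥ 0`,
  `H'² = (p/(p-1)) H H''`; `s = |v|^{p/2-1} v ∈ C¹` with `s² = H`, `2s'² ≤ H''`;
* `H₊ = (v₊)^p = (|v|^p + |v|^{p-1}v)/2`: the same list (`contDiff_two_posPart_rpow`, …).

The only delicate point is the origin, handled by `hasDerivAt_of_hasDerivAt_of_ne'`
(a continuous function with a continuous derivative off one point).

## References

* Z. Lei, Q. S. Zhang, J. Funct. Anal. 261 (2011) = arXiv:1011.5066, §2 p. 6 ("`f = |Γ|^q`")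
  and Cor. 3.3 p. 10 ("`(δ − Φ)₊` is a nonnegative sub-solution"). [LeiZhang2011]
-/

noncomputable section

open Real Filter Set
open scoped Topology

namespace Literature.Analysis.FluidPDE

namespace LeiZhang2011

/-! ### rpow algebra at the origin -/

/-- `|v|^r v² = |v|^{r+2}` (`r + 2 ≠ 0`). [folklore] -/
theorem abs_rpow_mul_sq (v : ℝ) {r : ℝ} (hr : r + 2 ≠ 0) : |v| ^ r * v ^ 2 = |v| ^ (r + 2) := by
  rw [rpow_add' (abs_nonneg v) hr, rpow_two, sq_abs]

/-- `|v|^a |v|^b = |v|^{a+b}` (`a + b ≠ 0`). [folklore] -/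
theorem abs_rpow_mul_abs_rpow (v : ℝ) {a b : ℝ} (h : a + b ≠ 0) :
    |v| ^ a * |v| ^ b = |v| ^ (a + b) :=
  (rpow_add' (abs_nonneg v) h).symm

/-! ### `|v|^r` off the origin, `|v|^{p-1} v` everywhere -/

/-- Off the origin `x ↦ |x|^r` has derivative `r|v|^{r-2}v` for every real `r`. [folklore] -/
theorem hasDerivAt_abs_rpow_of_ne {v : ℝ} (hv : v ≠ 0) (r : ℝ) :
    HasDerivAt (fun x : ℝ => |x| ^ r) (r * |v| ^ (r - 2) * v) v := by
  have h1 : HasDerivAt (fun x : ℝ => |x|) (SignType.sign v : ℝ) v := hasDerivAt_abs hv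
  have h2 : HasDerivAt (fun y : ℝ => y ^ r) (r * |v| ^ (r - 1)) |v| :=
    Real.hasDerivAt_rpow_const (Or.inl (abs_ne_zero.2 hv))
  have h := h2.comp v h1
  have hsub : |v| ^ (r - 1) = |v| ^ (r - 2) * |v| := by
    rw [show r - 1 = (r - 2) + 1 by ring, rpow_add (abs_pos.2 hv), rpow_one]
  have e : r * |v| ^ (r - 1) * (SignType.sign v : ℝ) = r * |v| ^ (r - 2) * v := by
    rw [hsub, mul_assoc, mul_assoc, abs_mul_sign, ← mul_assoc]
  rw [← e]
  exact h

/-- `x ↦ |x|^{p-1} x` (the odd power `sgn(x)|x|^p`) has derivative `p|v|^{p-1}` everywhere,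
for `p > 1` (off the origin by the product rule; at the origin from the continuity of the
function and of `p|·|^{p-1}`, `hasDerivAt_of_hasDerivAt_of_ne'`). [folklore] -/
theorem hasDerivAt_abs_rpow_sub_one_mul {p : ℝ} (hp : 1 < p) (v : ℝ) :
    HasDerivAt (fun x : ℝ => |x| ^ (p - 1) * x) (p * |v| ^ (p - 1)) v := by
  refine hasDerivAt_of_hasDerivAt_of_ne' (x := 0) (f := fun x : ℝ => |x| ^ (p - 1) * x)
    (g := fun y : ℝ => p * |y| ^ (p - 1)) (fun y hy => ?_) ?_ ?_ v
  · have h1 := (hasDerivAt_abs_rpow_of_ne hy (p - 1)).mul (hasDerivAt_id y)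
    have e : (p - 1) * |y| ^ (p - 1 - 2) * y * id y + |y| ^ (p - 1) * 1 = p * |y| ^ (p - 1) := by
      have h3 : |y| ^ (p - 1 - 2) * y * y = |y| ^ (p - 1) := by
        rw [mul_assoc, ← sq, abs_rpow_mul_sq y (by linarith : p - 1 - 2 + 2 ≠ 0)]
        ring_nf
      simp only [id]
      have : (p - 1) * |y| ^ (p - 1 - 2) * y * y = (p - 1) * |y| ^ (p - 1) := by
        rw [← h3]; ring
      linarith [this]
    rw [← e]
    exact h1
  · exact ((continuous_abs.rpow_const fun x => Or.inr (by linarith)).mul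
      continuous_id).continuousAt
  · exact (continuous_const.mul
      (continuous_abs.rpow_const fun x => Or.inr (by linarith))).continuousAt

/-- `deriv (x ↦ |x|^{p-1} x) = p |·|^{p-1}` (`p > 1`). [folklore] -/
theorem deriv_abs_rpow_sub_one_mul {p : ℝ} (hp : 1 < p) :
    deriv (fun x : ℝ => |x| ^ (p - 1) * x) = fun v => p * |v| ^ (p - 1) :=
  funext fun v => (hasDerivAt_abs_rpow_sub_one_mul hp v).deriv

/-- `x ↦ |x|^{p-1} x` is `C¹` for `p > 1`. [folklore] -/
theorem contDiff_one_abs_rpow_sub_one_mul {p : ℝ} (hp : 1 < p) :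
    ContDiff ℝ 1 fun x : ℝ => |x| ^ (p - 1) * x := by
  rw [contDiff_one_iff_deriv]
  refine ⟨fun v => (hasDerivAt_abs_rpow_sub_one_mul hp v).differentiableAt, ?_⟩
  rw [deriv_abs_rpow_sub_one_mul hp]
  exact continuous_const.mul (continuous_abs.rpow_const fun x => Or.inr (by linarith))

/-! ### `H = |v|^p`, `p > 2` -/

/-- `deriv |·|^p = p|·|^{p-2}·` (`p > 1`; Mathlib's `hasDerivAt_abs_rpow`). [folklore] -/
theorem deriv_abs_rpow {p : ℝ} (hp : 1 < p) :
    deriv (fun x : ℝ => |x| ^ p) = fun v => p * |v| ^ (p - 2) * v :=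
  funext fun v => (hasDerivAt_abs_rpow v hp).deriv

/-- `(|·|^p)'' = p(p-1)|·|^{p-2}` for `p > 2`. [folklore] -/
theorem deriv_deriv_abs_rpow {p : ℝ} (hp : 2 < p) :
    deriv (deriv fun x : ℝ => |x| ^ p) = fun v => p * (p - 1) * |v| ^ (p - 2) := by
  rw [deriv_abs_rpow (by linarith)]
  funext v
  have h1 : HasDerivAt (fun x : ℝ => |x| ^ (p - 1 - 1) * x) ((p - 1) * |v| ^ (p - 1 - 1)) v :=
    hasDerivAt_abs_rpow_sub_one_mul (p := p - 1) (by linarith) v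
  have h2 : HasDerivAt (fun x : ℝ => p * (|x| ^ (p - 2) * x)) (p * ((p - 1) * |v| ^ (p - 2))) v := by
    have := h1.const_mul p
    simpa [show p - 1 - 1 = p - 2 by ring] using this
  have e : (fun x : ℝ => p * |x| ^ (p - 2) * x) = fun x => p * (|x| ^ (p - 2) * x) :=
    funext fun x => by ring
  rw [e, h2.deriv]
  ring

/-- `|·|^p ∈ C²(ℝ)` for real `p > 2`. [folklore] -/
theorem contDiff_two_abs_rpow {p : ℝ} (hp : 2 < p) : ContDiff ℝ 2 fun x : ℝ => |x| ^ p := by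
  rw [show (2 : WithTop ℕ∞) = 1 + 1 by norm_num, contDiff_succ_iff_deriv]
  refine ⟨fun v => (hasDerivAt_abs_rpow v (by linarith)).differentiableAt,
    fun h => absurd h (by simp), ?_⟩
  rw [deriv_abs_rpow (by linarith)]
  have h1 : ContDiff ℝ 1 fun x : ℝ => |x| ^ (p - 1 - 1) * x :=
    contDiff_one_abs_rpow_sub_one_mul (p := p - 1) (by linarith)
  have e : (fun x : ℝ => p * |x| ^ (p - 2) * x) = fun x => p * (|x| ^ (p - 1 - 1) * x) :=
    funext fun x => by rw [show p - 1 - 1 = p - 2 by ring]; ring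
  rw [e]
  exact contDiff_const.mul h1

/-- `|v|^p ≥ 0`. [folklore] -/
theorem abs_rpow_nonneg (v p : ℝ) : 0 ≤ |v| ^ p := rpow_nonneg (abs_nonneg v) p

/-- `|0|^p = 0` (`p ≠ 0`). [folklore] -/
theorem abs_rpow_zero_of_ne {p : ℝ} (hp : p ≠ 0) : |(0 : ℝ)| ^ p = 0 := by
  rw [abs_zero, zero_rpow hp]

/-- `(|·|^p)'' ≥ 0` (`p > 2`). [folklore] -/
theorem deriv_deriv_abs_rpow_nonneg {p : ℝ} (hp : 2 < p) (v : ℝ) :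
    0 ≤ deriv (deriv fun x : ℝ => |x| ^ p) v := by
  rw [deriv_deriv_abs_rpow hp]
  have : 0 ≤ p * (p - 1) := by nlinarith
  exact mul_nonneg this (abs_rpow_nonneg v _)

/-- **The structure constant of `|v|^p`**: `H'² = (p/(p-1)) H H''`, hence
`H'² ≤ (p/(p-1)) H H''` (`p > 2`). [folklore] -/
theorem deriv_abs_rpow_sq_le {p : ℝ} (hp : 2 < p) (v : ℝ) :
    deriv (fun x : ℝ => |x| ^ p) v ^ 2 ≤
      p / (p - 1) * (|v| ^ p * deriv (deriv fun x : ℝ => |x| ^ p) v) := by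
  rw [deriv_deriv_abs_rpow hp, deriv_abs_rpow (by linarith)]
  beta_reduce
  have hp1 : p - 1 ≠ 0 := by linarith
  have h1 : (p * |v| ^ (p - 2) * v) ^ 2 = p ^ 2 * (|v| ^ (p - 2) * |v| ^ p) := by
    rw [show (p * |v| ^ (p - 2) * v) ^ 2 = p ^ 2 * |v| ^ (p - 2) * (|v| ^ (p - 2) * v ^ 2) by ring,
      abs_rpow_mul_sq v (by linarith : p - 2 + 2 ≠ 0), show p - 2 + 2 = p by ring]
    ring
  have h2 : p / (p - 1) * (|v| ^ p * (p * (p - 1) * |v| ^ (p - 2))) =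
      p ^ 2 * (|v| ^ (p - 2) * |v| ^ p) := by
    field_simp
  rw [h1, h2]

/-! ### the signed square root `s = |v|^{p/2-1} v` of `|v|^p` -/

/-- `(|v|^{p/2-1} v)² = |v|^p` (`p ≠ 0`). [folklore] -/
theorem abs_rpow_half_sub_one_mul_sq {p : ℝ} (hp : p ≠ 0) (v : ℝ) :
    (|v| ^ (p / 2 - 1) * v) ^ 2 = |v| ^ p := by
  rw [mul_pow, ← rpow_natCast (|v| ^ (p / 2 - 1)) 2, ← rpow_mul (abs_nonneg v), Nat.cast_ofNat,
    abs_rpow_mul_sq v (by intro h; apply hp; linarith), show (p / 2 - 1) * 2 + 2 = p by ring]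

/-- `s = |v|^{p/2-1} v` is `C¹` for `p > 2`. [folklore] -/
theorem contDiff_one_abs_rpow_half_sub_one_mul {p : ℝ} (hp : 2 < p) :
    ContDiff ℝ 1 fun x : ℝ => |x| ^ (p / 2 - 1) * x :=
  contDiff_one_abs_rpow_sub_one_mul (p := p / 2) (by linarith)

/-- `s' = (p/2)|v|^{p/2-1}` for `s = |v|^{p/2-1} v`, `p > 2`. [folklore] -/
theorem deriv_abs_rpow_half_sub_one_mul {p : ℝ} (hp : 2 < p) (v : ℝ) :
    deriv (fun x : ℝ => |x| ^ (p / 2 - 1) * x) v = p / 2 * |v| ^ (p / 2 - 1) :=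
  (hasDerivAt_abs_rpow_sub_one_mul (p := p / 2) (by linarith) v).deriv

/-- `2 s'² ≤ H''` for `s = |v|^{p/2-1} v`, `H = |v|^p`, `p > 2`
(`2(p/2)²|v|^{p-2} ≤ p(p-1)|v|^{p-2}` as `p ≥ 2`). [folklore] -/
theorem two_mul_deriv_abs_rpow_half_sq_le {p : ℝ} (hp : 2 < p) (v : ℝ) :
    2 * deriv (fun x : ℝ => |x| ^ (p / 2 - 1) * x) v ^ 2 ≤
      deriv (deriv fun x : ℝ => |x| ^ p) v := by
  rw [deriv_abs_rpow_half_sub_one_mul hp, deriv_deriv_abs_rpow hp, mul_pow,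
    ← rpow_natCast (|v| ^ (p / 2 - 1)) 2, ← rpow_mul (abs_nonneg v), Nat.cast_ofNat,
    show (p / 2 - 1) * 2 = p - 2 by ring]
  have h0 := abs_rpow_nonneg v (p - 2)
  nlinarith [h0, mul_nonneg (by linarith : (0 : ℝ) ≤ p - 2) h0]

/-! ### the positive part `(v₊)^p = (|v|^p + |v|^{p-1} v)/2` -/

/-- `(max v 0)^p = (|v|^p + |v|^{p-1} v)/2` (`p ≠ 0`). [folklore] -/
theorem posPart_rpow_eq {p : ℝ} (hp : p ≠ 0) (v : ℝ) :
    max v 0 ^ p = (|v| ^ p + |v| ^ (p - 1) * v) / 2 := by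
  rcases le_or_gt 0 v with hv | hv
  · rw [max_eq_left hv, abs_of_nonneg hv]
    rcases hv.eq_or_lt with h0 | h0
    · rw [← h0, zero_rpow hp]; simp
    · rw [rpow_sub_one h0.ne', div_mul_cancel₀ _ h0.ne']
      ring
  · rw [max_eq_right hv.le, zero_rpow hp]
    have hv0 : v ≠ 0 := hv.ne
    have h1 : |v| ^ (p - 1) * v = -|v| ^ p := by
      rw [rpow_sub_one (abs_ne_zero.2 hv0), abs_of_neg hv]
      field_simp
    rw [h1]; ring

/-- `x ↦ |x|^{p-1} x` is `C²` for `p > 2` (its derivative `p|·|^{p-1}` is `C¹`, Mathlib's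
`contDiff_norm_rpow`). [folklore] -/
theorem contDiff_two_abs_rpow_sub_one_mul {p : ℝ} (hp : 2 < p) :
    ContDiff ℝ 2 fun x : ℝ => |x| ^ (p - 1) * x := by
  rw [show (2 : WithTop ℕ∞) = 1 + 1 by norm_num, contDiff_succ_iff_deriv]
  refine ⟨fun v => (hasDerivAt_abs_rpow_sub_one_mul (by linarith) v).differentiableAt,
    fun h => absurd h (by simp), ?_⟩
  rw [deriv_abs_rpow_sub_one_mul (by linarith)]
  have h1 : ContDiff ℝ 1 fun x : ℝ => ‖x‖ ^ (p - 1) := contDiff_norm_rpow (by linarith)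
  simp only [Real.norm_eq_abs] at h1
  exact contDiff_const.mul h1

/-- `(·)₊^p ∈ C²(ℝ)` for real `p > 2`. [folklore] -/
theorem contDiff_two_posPart_rpow {p : ℝ} (hp : 2 < p) : ContDiff ℝ 2 fun x : ℝ => max x 0 ^ p := by
  have e : (fun x : ℝ => max x 0 ^ p) = fun x => (|x| ^ p + |x| ^ (p - 1) * x) / 2 :=
    funext (posPart_rpow_eq (by linarith))
  rw [e]
  exact ((contDiff_two_abs_rpow hp).add (contDiff_two_abs_rpow_sub_one_mul hp)).div_const 2

/-- `deriv (·)₊^p = p (·)₊^{p-1}` for `p > 2`. [folklore] -/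
theorem deriv_posPart_rpow {p : ℝ} (hp : 2 < p) :
    deriv (fun x : ℝ => max x 0 ^ p) = fun v => p * max v 0 ^ (p - 1) := by
  have e : (fun x : ℝ => max x 0 ^ p) = fun x => (|x| ^ p + |x| ^ (p - 1) * x) / 2 :=
    funext (posPart_rpow_eq (by linarith))
  rw [e]
  funext v
  have h : HasDerivAt (fun x : ℝ => (|x| ^ p + |x| ^ (p - 1) * x) / 2)
      ((p * |v| ^ (p - 2) * v + p * |v| ^ (p - 1)) / 2) v :=
    ((hasDerivAt_abs_rpow v (by linarith : 1 < p)).add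
      (hasDerivAt_abs_rpow_sub_one_mul (by linarith : 1 < p) v)).div_const 2
  rw [h.deriv, posPart_rpow_eq (by linarith : p - 1 ≠ 0), show p - 1 - 1 = p - 2 by ring]
  ring

/-- `((·)₊^p)'' = p(p-1)(·)₊^{p-2}` for `p > 2`. [folklore] -/
theorem deriv_deriv_posPart_rpow {p : ℝ} (hp : 2 < p) :
    deriv (deriv fun x : ℝ => max x 0 ^ p) = fun v => p * (p - 1) * max v 0 ^ (p - 2) := by
  rw [deriv_posPart_rpow hp]
  funext v
  -- `(·)₊^{p-1} = (|·|^{p-1} + |·|^{p-2}·)/2` with `p - 1 > 1`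
  have e : (fun x : ℝ => p * max x 0 ^ (p - 1)) =
      fun x => p * ((|x| ^ (p - 1) + |x| ^ (p - 1 - 1) * x) / 2) :=
    funext fun x => by rw [posPart_rpow_eq (by linarith : p - 1 ≠ 0)]
  rw [e]
  have h : HasDerivAt (fun x : ℝ => p * ((|x| ^ (p - 1) + |x| ^ (p - 1 - 1) * x) / 2))
      (p * (((p - 1) * |v| ^ (p - 1 - 2) * v + (p - 1) * |v| ^ (p - 1 - 1)) / 2)) v :=
    (((hasDerivAt_abs_rpow v (by linarith : 1 < p - 1)).add
      (hasDerivAt_abs_rpow_sub_one_mul (by linarith : 1 < p - 1) v)).div_const 2).const_mul p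
  rw [h.deriv, posPart_rpow_eq (by linarith : p - 2 ≠ 0), show p - 1 - 2 = p - 2 - 1 by ring,
    show p - 1 - 1 = p - 2 by ring]
  ring

/-- `(v₊)^p ≥ 0`. [folklore] -/
theorem posPart_rpow_nonneg (v p : ℝ) : 0 ≤ max v 0 ^ p := rpow_nonneg (le_max_right _ _) p

/-- `(v₊)^p = 0` for `v ≤ 0` (`p ≠ 0`). [folklore] -/
theorem posPart_rpow_of_nonpos {v p : ℝ} (hv : v ≤ 0) (hp : p ≠ 0) : max v 0 ^ p = 0 := by
  rw [max_eq_right hv, zero_rpow hp]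

/-- `((·)₊^p)'' ≥ 0` (`p > 2`). [folklore] -/
theorem deriv_deriv_posPart_rpow_nonneg {p : ℝ} (hp : 2 < p) (v : ℝ) :
    0 ≤ deriv (deriv fun x : ℝ => max x 0 ^ p) v := by
  rw [deriv_deriv_posPart_rpow hp]
  have : 0 ≤ p * (p - 1) := by nlinarith
  exact mul_nonneg this (posPart_rpow_nonneg v _)

/-- `(v₊)^a (v₊)^b = (v₊)^{a+b}` (`a + b ≠ 0`). [folklore] -/
theorem posPart_rpow_mul_posPart_rpow (v : ℝ) {a b : ℝ} (h : a + b ≠ 0) :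
    max v 0 ^ a * max v 0 ^ b = max v 0 ^ (a + b) :=
  (rpow_add' (le_max_right _ _) h).symm

/-- **The structure constant of `(v₊)^p`**: `H'² ≤ (p/(p-1)) H H''` (`p > 2`; equality).
[folklore] -/
theorem deriv_posPart_rpow_sq_le {p : ℝ} (hp : 2 < p) (v : ℝ) :
    deriv (fun x : ℝ => max x 0 ^ p) v ^ 2 ≤
      p / (p - 1) * (max v 0 ^ p * deriv (deriv fun x : ℝ => max x 0 ^ p) v) := by
  rw [deriv_deriv_posPart_rpow hp, deriv_posPart_rpow hp]
  beta_reduce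
  have hp1 : p - 1 ≠ 0 := by linarith
  have h1 : (p * max v 0 ^ (p - 1)) ^ 2 = p ^ 2 * max v 0 ^ (2 * p - 2) := by
    rw [mul_pow, ← rpow_natCast (max v 0 ^ (p - 1)) 2, ← rpow_mul (le_max_right _ _),
      Nat.cast_ofNat, show (p - 1) * 2 = 2 * p - 2 by ring]
  have h2 : p / (p - 1) * (max v 0 ^ p * (p * (p - 1) * max v 0 ^ (p - 2))) =
      p ^ 2 * max v 0 ^ (2 * p - 2) := by
    rw [show max v 0 ^ p * (p * (p - 1) * max v 0 ^ (p - 2)) =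
        p * (p - 1) * (max v 0 ^ p * max v 0 ^ (p - 2)) by ring,
      posPart_rpow_mul_posPart_rpow v (by linarith : p + (p - 2) ≠ 0),
      show p + (p - 2) = 2 * p - 2 by ring]
    field_simp
  rw [h1, h2]

/-! ### the square root `s₊ = (v₊)^{p/2}` of `(v₊)^p` -/

/-- `((v₊)^{p/2})² = (v₊)^p`. [folklore] -/
theorem posPart_rpow_half_sq (p v : ℝ) : (max v 0 ^ (p / 2)) ^ 2 = max v 0 ^ p := by
  rw [← rpow_natCast (max v 0 ^ (p / 2)) 2, ← rpow_mul (le_max_right _ _), Nat.cast_ofNat]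
  ring_nf

/-- `s₊ = (v₊)^{p/2}` is `C¹` for `p > 2` (`p/2 > 1`; it is `(|v|^{p/2} + |v|^{p/2-1}v)/2`).
[folklore] -/
theorem contDiff_one_posPart_rpow_half {p : ℝ} (hp : 2 < p) :
    ContDiff ℝ 1 fun x : ℝ => max x 0 ^ (p / 2) := by
  have e : (fun x : ℝ => max x 0 ^ (p / 2)) = fun x => (|x| ^ (p / 2) + |x| ^ (p / 2 - 1) * x) / 2 :=
    funext (posPart_rpow_eq (by linarith))
  rw [e]
  have h1 : ContDiff ℝ 1 fun x : ℝ => ‖x‖ ^ (p / 2) := contDiff_norm_rpow (by linarith)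
  simp only [Real.norm_eq_abs] at h1
  exact (h1.add (contDiff_one_abs_rpow_sub_one_mul (p := p / 2) (by linarith))).div_const 2

/-- `s₊' = (p/2)(v₊)^{p/2-1}` for `p > 2`. [folklore] -/
theorem deriv_posPart_rpow_half {p : ℝ} (hp : 2 < p) (v : ℝ) :
    deriv (fun x : ℝ => max x 0 ^ (p / 2)) v = p / 2 * max v 0 ^ (p / 2 - 1) := by
  have e : (fun x : ℝ => max x 0 ^ (p / 2)) = fun x => (|x| ^ (p / 2) + |x| ^ (p / 2 - 1) * x) / 2 :=
    funext (posPart_rpow_eq (by linarith))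
  rw [e]
  have h : HasDerivAt (fun x : ℝ => (|x| ^ (p / 2) + |x| ^ (p / 2 - 1) * x) / 2)
      ((p / 2 * |v| ^ (p / 2 - 2) * v + p / 2 * |v| ^ (p / 2 - 1)) / 2) v :=
    ((hasDerivAt_abs_rpow v (by linarith : 1 < p / 2)).add
      (hasDerivAt_abs_rpow_sub_one_mul (by linarith : 1 < p / 2) v)).div_const 2
  rw [h.deriv, posPart_rpow_eq (by linarith : p / 2 - 1 ≠ 0), show p / 2 - 1 - 1 = p / 2 - 2 by ring]
  ring

/-- `2 s₊'² ≤ H₊''` for `s₊ = (v₊)^{p/2}`, `H₊ = (v₊)^p`, `p > 2`. [folklore] -/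
theorem two_mul_deriv_posPart_rpow_half_sq_le {p : ℝ} (hp : 2 < p) (v : ℝ) :
    2 * deriv (fun x : ℝ => max x 0 ^ (p / 2)) v ^ 2 ≤
      deriv (deriv fun x : ℝ => max x 0 ^ p) v := by
  rw [deriv_posPart_rpow_half hp, deriv_deriv_posPart_rpow hp, mul_pow,
    ← rpow_natCast (max v 0 ^ (p / 2 - 1)) 2, ← rpow_mul (le_max_right _ _), Nat.cast_ofNat,
    show (p / 2 - 1) * 2 = p - 2 by ring]
  have h0 := posPart_rpow_nonneg v (p - 2)
  nlinarith [h0, mul_nonneg (by linarith : (0 : ℝ) ≤ p - 2) h0]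

end LeiZhang2011

end Literature.Analysis.FluidPDE

namespace Literature.Analysis.FluidPDE

namespace LeiZhang2011

open Real

/-! ### the reflected positive part `((c - v)₊)^p` (for `(δ − Φ)₊`, Cor. 3.3) -/

/-- `deriv ((c - ·)₊^p) = -p ((c - ·)₊)^{p-1}` (`p > 2`). [folklore] -/
theorem deriv_posPart_const_sub_rpow {p : ℝ} (hp : 2 < p) (c : ℝ) :
    deriv (fun x : ℝ => max (c - x) 0 ^ p) = fun v => -(p * max (c - v) 0 ^ (p - 1)) := by
  funext v
  rw [deriv_comp_const_sub (f := fun y : ℝ => max y 0 ^ p), deriv_posPart_rpow hp]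

/-- `((c - ·)₊^p)'' = p(p-1)((c - ·)₊)^{p-2}` (`p > 2`). [folklore] -/
theorem deriv_deriv_posPart_const_sub_rpow {p : ℝ} (hp : 2 < p) (c : ℝ) :
    deriv (deriv fun x : ℝ => max (c - x) 0 ^ p) = fun v => p * (p - 1) * max (c - v) 0 ^ (p - 2) := by
  rw [deriv_posPart_const_sub_rpow hp c]
  funext v
  have e : (fun v : ℝ => -(p * max (c - v) 0 ^ (p - 1))) =
      fun v => -((fun y : ℝ => p * max y 0 ^ (p - 1)) (c - v)) := rfl
  rw [e, deriv.fun_neg, deriv_comp_const_sub (f := fun y : ℝ => p * max y 0 ^ (p - 1)), neg_neg,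
    ← deriv_posPart_rpow hp, deriv_deriv_posPart_rpow hp]

/-- `((c - ·)₊)^p ∈ C²(ℝ)` for `p > 2`. [folklore] -/
theorem contDiff_two_posPart_const_sub_rpow {p : ℝ} (hp : 2 < p) (c : ℝ) :
    ContDiff ℝ 2 fun x : ℝ => max (c - x) 0 ^ p :=
  (contDiff_two_posPart_rpow hp).comp (contDiff_const.sub contDiff_id)

/-- `((c - 0)₊)^p = 0` for `c ≤ 0` (`p ≠ 0`): the nonlinearity vanishes at `0`, so the axis
term of the energy identity needs no boundary contribution. [folklore] -/
theorem posPart_const_sub_rpow_zero {c p : ℝ} (hc : c ≤ 0) (hp : p ≠ 0) :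
    max (c - 0) 0 ^ p = 0 := by
  rw [sub_zero, posPart_rpow_of_nonpos hc hp]

/-- `(((c - ·)₊)^p)'' ≥ 0` (`p > 2`). [folklore] -/
theorem deriv_deriv_posPart_const_sub_rpow_nonneg {p : ℝ} (hp : 2 < p) (c v : ℝ) :
    0 ≤ deriv (deriv fun x : ℝ => max (c - x) 0 ^ p) v := by
  rw [deriv_deriv_posPart_const_sub_rpow hp]
  have : 0 ≤ p * (p - 1) := by nlinarith
  exact mul_nonneg this (posPart_rpow_nonneg _ _)

/-- **The structure constant of `((c - v)₊)^p`**: `H'² ≤ (p/(p-1)) H H''` (`p > 2`). [folklore] -/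
theorem deriv_posPart_const_sub_rpow_sq_le {p : ℝ} (hp : 2 < p) (c v : ℝ) :
    deriv (fun x : ℝ => max (c - x) 0 ^ p) v ^ 2 ≤
      p / (p - 1) * (max (c - v) 0 ^ p * deriv (deriv fun x : ℝ => max (c - x) 0 ^ p) v) := by
  have h := deriv_posPart_rpow_sq_le hp (c - v)
  rw [deriv_deriv_posPart_rpow hp, deriv_posPart_rpow hp] at h
  rw [deriv_deriv_posPart_const_sub_rpow hp, deriv_posPart_const_sub_rpow hp]
  simpa only [neg_sq] using h

/-- `s = ((c - ·)₊)^{p/2}` is `C¹` for `p > 2`. [folklore] -/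
theorem contDiff_one_posPart_const_sub_rpow_half {p : ℝ} (hp : 2 < p) (c : ℝ) :
    ContDiff ℝ 1 fun x : ℝ => max (c - x) 0 ^ (p / 2) :=
  (contDiff_one_posPart_rpow_half hp).comp (contDiff_const.sub contDiff_id)

/-- `(((c - v)₊)^{p/2})² = ((c - v)₊)^p`. [folklore] -/
theorem posPart_const_sub_rpow_half_sq (p c v : ℝ) :
    (max (c - v) 0 ^ (p / 2)) ^ 2 = max (c - v) 0 ^ p :=
  posPart_rpow_half_sq p (c - v)

/-- `2 s'² ≤ H''` for `s = ((c - ·)₊)^{p/2}`, `H = ((c - ·)₊)^p`, `p > 2`. [folklore] -/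
theorem two_mul_deriv_posPart_const_sub_rpow_half_sq_le {p : ℝ} (hp : 2 < p) (c v : ℝ) :
    2 * deriv (fun x : ℝ => max (c - x) 0 ^ (p / 2)) v ^ 2 ≤
      deriv (deriv fun x : ℝ => max (c - x) 0 ^ p) v := by
  have h := two_mul_deriv_posPart_rpow_half_sq_le hp (c - v)
  rw [deriv_deriv_posPart_rpow hp] at h
  rw [deriv_deriv_posPart_const_sub_rpow hp,
    deriv_comp_const_sub (f := fun y : ℝ => max y 0 ^ (p / 2)), neg_sq]
  exact h

end LeiZhang2011

end Literature.Analysis.FluidPDE
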